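import Literature.Probability.Percolation.LonelyClusterExchange
import Literature.Probability.Percolation.KozmaNitzanPreFKG
import HarnessLib

/-!
# `NoHeavyLowerTail` (stmt-CriticalPhenomena-4575) — the LIGHTNESS DIAMOND and the reduction of
# "own lightness hurts most" to one negative-correlation inequality

Bond percolation `μ = prodBernoulli w` on a finite vertex type, relays `A : Finset V`, level `j`, vertices
`o, x, y`; `R_v = {|π(v)| ≤ j}` (`π(v) = A.filter (v ↔ ·)`, "`v` is light"), `R_vᶜ` = "`v` is heavy",
`Q = {o ↔ x}`.

* `lightnessDiamond` (PROVED, one application of van den Berg–Häggström–Kahn's two-cluster exchange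
  `twoClusterExchange` with `s = x`, `t = y`):
  `μ(Q ∩ R_x ∩ R_yᶜ) · μ(R_xᶜ ∩ R_y) ≤ μ(Q ∩ R_xᶜ ∩ R_y) · μ(R_x ∩ R_yᶜ)`,
  i.e. `P(o ↔ x | x light, y heavy) ≤ P(o ↔ x | x heavy, y light)` — the cluster-cardinality analogue of the
  "diamond" `μ(o↔x | x↮b, y↔b) ≤ μ(o↔x | x↔b, y↮b)` of `…NoHeavyLowerTailOwnDisconnection.lean`.
  (`{x light} ∩ {y heavy} ⊆ {x ↮ y}`, so the conditioning on `{x ↮ y}` of the exchange inequality is free.)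
* `ownLightness_le_of_negCorr` (bookkeeping, the template of `…OwnDisconnection.lean`): IF
  `μ(R_x) · μ(Q ∩ R_x ∩ R_yᶜ) ≤ μ(Q ∩ R_x) · μ(R_x ∩ R_yᶜ)` ("given `x` light, `{o ↔ x}` and `{y heavy}` are
  negatively correlated" — hypothesis `hNEG`, NOT proved here; 0 violations in 2 736 exact random instances, see the
  coupling seat's A5-COUPLING-gen2.md §2) and `μ(R_y) ≤ μ(R_x)`, THEN
  `μ(Q ∩ R_x) · μ(R_y) ≤ μ(Q ∩ R_y) · μ(R_x)`, i.e. `P(o ↔ x | x light) ≤ P(o ↔ x | y light)`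
  ("own lightness hurts most", the cardinality twin of `(M₂)`; it implies the two-relay prefix packing
  `prefixPacking_two` and is the first rung of the cumulative chain CMCIL ⇒ BCR ⇒ CIL of the memo).
-/

noncomputable section

namespace Summit.CriticalPhenomena.PercolationContinuityZ3.Theorems

open MeasureTheory Set
open Literature.Probability.LatticeModels (prodBernoulli)
open Literature.Probability.Percolation
open Literature.Probability.Percolation.TwoClusterExchange
open Literature.Probability.Percolation.LonelyClusterExchange
open scoped Classical

variable {V : Type*}

namespace LightnessDiamond

/-- `{|π(s)| > j}` (complement of the type-`(−)` event `R_s`) is of type `(+)` for the pair `(s, t)`. [folklore] -/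
theorem typePlus_card_gt (A : Finset V) (j : ℕ) (s t : V) ⦃ω ω' : BondConfig V⦄
    (hs : openEdgeCluster ω s ⊆ openEdgeCluster ω' s) (ht : openEdgeCluster ω' t ⊆ openEdgeCluster ω t)
    (h : ω ∈ {ω : BondConfig V | (A.filter fun z => ω ∈ openConn s z).card ≤ j}ᶜ) :
    ω' ∈ {ω : BondConfig V | (A.filter fun z => ω ∈ openConn s z).card ≤ j}ᶜ :=
  fun h' => h (typeMinus_card_le A j s t hs ht h')

/-- `{|π(t)| > j}` (complement of the type-`(+)` event `R_t`) is of type `(−)` for the pair `(s, t)`. [folklore] -/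
theorem typeMinus_card_gt (A : Finset V) (j : ℕ) (s t : V) ⦃ω ω' : BondConfig V⦄
    (hs : openEdgeCluster ω' s ⊆ openEdgeCluster ω s) (ht : openEdgeCluster ω t ⊆ openEdgeCluster ω' t)
    (h : ω ∈ {ω : BondConfig V | (A.filter fun z => ω ∈ openConn t z).card ≤ j}ᶜ) :
    ω' ∈ {ω : BondConfig V | (A.filter fun z => ω ∈ openConn t z).card ≤ j}ᶜ :=
  fun h' => h (typePlus_card_le A j s t hs ht h')

/-- If `x ↔ y` then `π(x) = π(y)`. [folklore] -/
theorem filter_eq_of_openConn (A : Finset V) (x y : V) {ω : BondConfig V}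
    (h : ω ∈ (openConn x y : Set (BondConfig V))) :
    (A.filter fun z => ω ∈ openConn x z) = (A.filter fun z => ω ∈ openConn y z) := by
  have hxy : (openGraph ω).Reachable x y := h
  exact Finset.filter_congr fun z _ =>
    ⟨fun hz => (hxy.symm.trans hz : (openGraph ω).Reachable y z),
      fun hz => (hxy.trans hz : (openGraph ω).Reachable x z)⟩

/-- `{x light} ∩ {y heavy} ⊆ {x ↮ y}`. [folklore] -/
theorem light_inter_heavy_subset (A : Finset V) (j : ℕ) (x y : V) :
    ({ω : BondConfig V | (A.filter fun z => ω ∈ openConn x z).card ≤ j} ∩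
        {ω : BondConfig V | (A.filter fun z => ω ∈ openConn y z).card ≤ j}ᶜ) ⊆
      (openConn x y : Set (BondConfig V))ᶜ := by
  rintro ω ⟨hx, hy⟩ hxy
  apply hy
  simp only [mem_setOf_eq] at hx ⊢
  rwa [← filter_eq_of_openConn A x y hxy]

end LightnessDiamond

open LightnessDiamond

/-- **Lightness diamond.**  For `x ≠ y`, any `o`, `A`, `j`, with `R_v = {|π(v)| ≤ j}`:
`μ({o ↔ x} ∩ R_x ∩ R_yᶜ) · μ(R_xᶜ ∩ R_y) ≤ μ({o ↔ x} ∩ R_xᶜ ∩ R_y) · μ(R_x ∩ R_yᶜ)`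
(`P(o ↔ x | x light, y heavy) ≤ P(o ↔ x | x heavy, y light)`).  One application of the two-cluster exchange
inequality (BHK 2006 Thm 1.5, event form `twoClusterExchange`) with `s = x`, `t = y`, `A₁ = {x ↔ o}`,
`B₁ = R_x ∩ R_yᶜ`, `A₂ = R_xᶜ ∩ R_y`, `B₂ = ⊤`; the conditioning `{x ↮ y}` is implied by both cells.
[cite: VandenbergHaggstromKahn2005, Thm. 1.5 (p. 7) — corollary, derived in this file] -/
theorem lightnessDiamond [Fintype V] (w : Sym2 V → unitInterval) (A : Finset V) (o x y : V) (j : ℕ)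
    (hxy : x ≠ y) :
    (prodBernoulli w).real (openConn o x ∩ {ω : BondConfig V | (A.filter fun z => ω ∈ openConn x z).card ≤ j} ∩
        {ω : BondConfig V | (A.filter fun z => ω ∈ openConn y z).card ≤ j}ᶜ) *
      (prodBernoulli w).real ({ω : BondConfig V | (A.filter fun z => ω ∈ openConn x z).card ≤ j}ᶜ ∩
        {ω : BondConfig V | (A.filter fun z => ω ∈ openConn y z).card ≤ j}) ≤
    (prodBernoulli w).real (openConn o x ∩ {ω : BondConfig V | (A.filter fun z => ω ∈ openConn x z).card ≤ j}ᶜ ∩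
        {ω : BondConfig V | (A.filter fun z => ω ∈ openConn y z).card ≤ j}) *
      (prodBernoulli w).real ({ω : BondConfig V | (A.filter fun z => ω ∈ openConn x z).card ≤ j} ∩
        {ω : BondConfig V | (A.filter fun z => ω ∈ openConn y z).card ≤ j}ᶜ) := by
  set Rx : Set (BondConfig V) := {ω | (A.filter fun z => ω ∈ openConn x z).card ≤ j} with hRx
  set Ry : Set (BondConfig V) := {ω | (A.filter fun z => ω ∈ openConn y z).card ≤ j} with hRy
  set D : Set (BondConfig V) := (openConn x y)ᶜ with hD
  have key := twoClusterExchange w hxy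
    (A₁ := (openConn x o : Set (BondConfig V))) (A₂ := Rxᶜ ∩ Ry) (B₁ := Rx ∩ Ryᶜ)
    (B₂ := (univ : Set (BondConfig V)))
    (fun ω ω' h1 h2 hω => typePlus_openConn x y o h1 h2 hω)
    (fun ω ω' h1 h2 hω => ⟨typePlus_card_gt A j x y h1 h2 hω.1, typePlus_card_le A j x y h1 h2 hω.2⟩)
    (fun ω ω' h1 h2 hω => ⟨typeMinus_card_le A j x y h1 h2 hω.1, typeMinus_card_gt A j x y h1 h2 hω.2⟩)
    (fun _ _ _ _ _ => mem_univ _)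
  -- remove the conditioning `D`: both mixed cells lie inside `{x ↮ y}`
  have hF : D ∩ (Rx ∩ Ryᶜ) = Rx ∩ Ryᶜ :=
    inter_eq_right.mpr (light_inter_heavy_subset A j x y)
  have hG : D ∩ (Rxᶜ ∩ Ry) = Rxᶜ ∩ Ry := by
    refine inter_eq_right.mpr ?_
    intro ω hω
    have h' := light_inter_heavy_subset A j y x ⟨hω.2, hω.1⟩
    intro hc
    exact h' (SimpleGraph.Reachable.symm hc : (openGraph ω).Reachable y x)
  have h1 : D ∩ ((openConn x o : Set (BondConfig V)) ∩ (Rx ∩ Ryᶜ)) = openConn o x ∩ Rx ∩ Ryᶜ := by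
    rw [Literature.Probability.Percolation.KNPreFKG.openConn_symm o x, ← inter_assoc, inter_comm D, inter_assoc, hF, ← inter_assoc]
  have h2 : D ∩ (Rxᶜ ∩ Ry ∩ univ) = Rxᶜ ∩ Ry := by rw [inter_univ, hG]
  have h3 : D ∩ ((openConn x o : Set (BondConfig V)) ∩ (Rxᶜ ∩ Ry)) = openConn o x ∩ Rxᶜ ∩ Ry := by
    rw [Literature.Probability.Percolation.KNPreFKG.openConn_symm o x, ← inter_assoc, inter_comm D, inter_assoc, hG, ← inter_assoc]
  have h4 : D ∩ (Rx ∩ Ryᶜ ∩ univ) = Rx ∩ Ryᶜ := by rw [inter_univ, hF]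
  rw [h1, h2, h3, h4] at key
  exact key

/-- **"Own lightness hurts most", conditionally on the negative-correlation inequality NEG.**  For `x ≠ y`
with `μ(R_y) ≤ μ(R_x)`: IF `μ(R_x)·μ({o↔x} ∩ R_x ∩ R_yᶜ) ≤ μ({o↔x} ∩ R_x)·μ(R_x ∩ R_yᶜ)` (hypothesis `hNEG`:
given `x` light, `{o ↔ x}` and `{y heavy}` are negatively correlated), THEN
`μ({o↔x} ∩ R_x)·μ(R_y) ≤ μ({o↔x} ∩ R_y)·μ(R_x)`, i.e. `P(o ↔ x | x light) ≤ P(o ↔ x | y light)`.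
Proof: the bookkeeping of `…OwnDisconnection.lean` — with `F = R_x ∩ R_yᶜ`, `G = R_xᶜ ∩ R_y`,
`L = μ(R_x)μ(QF) − μ(QR_x)μ(F) ≤ 0` (NEG), `R = μ(R_x)μ(QG) − μ(QR_x)μ(G)`, the diamond gives
`μ(G)·L ≤ μ(F)·R`, and `μ(G) ≤ μ(F)`. [this file] -/
theorem ownLightness_le_of_negCorr [Fintype V] (w : Sym2 V → unitInterval) (A : Finset V) (o x y : V)
    (j : ℕ) (hxy : x ≠ y)
    (hI : (prodBernoulli w).real {ω : BondConfig V | (A.filter fun z => ω ∈ openConn y z).card ≤ j} ≤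
      (prodBernoulli w).real {ω : BondConfig V | (A.filter fun z => ω ∈ openConn x z).card ≤ j})
    (hNEG : (prodBernoulli w).real {ω : BondConfig V | (A.filter fun z => ω ∈ openConn x z).card ≤ j} *
        (prodBernoulli w).real (openConn o x ∩
          {ω : BondConfig V | (A.filter fun z => ω ∈ openConn x z).card ≤ j} ∩
          {ω : BondConfig V | (A.filter fun z => ω ∈ openConn y z).card ≤ j}ᶜ) ≤
      (prodBernoulli w).real (openConn o x ∩
          {ω : BondConfig V | (A.filter fun z => ω ∈ openConn x z).card ≤ j}) *
        (prodBernoulli w).real ({ω : BondConfig V | (A.filter fun z => ω ∈ openConn x z).card ≤ j} ∩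
          {ω : BondConfig V | (A.filter fun z => ω ∈ openConn y z).card ≤ j}ᶜ)) :
    (prodBernoulli w).real (openConn o x ∩ {ω : BondConfig V | (A.filter fun z => ω ∈ openConn x z).card ≤ j}) *
        (prodBernoulli w).real {ω : BondConfig V | (A.filter fun z => ω ∈ openConn y z).card ≤ j} ≤
      (prodBernoulli w).real (openConn o x ∩ {ω : BondConfig V | (A.filter fun z => ω ∈ openConn y z).card ≤ j}) *
        (prodBernoulli w).real {ω : BondConfig V | (A.filter fun z => ω ∈ openConn x z).card ≤ j} := by
  set μ := prodBernoulli w with hμ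
  set Rx : Set (BondConfig V) := {ω | (A.filter fun z => ω ∈ openConn x z).card ≤ j} with hRx
  set Ry : Set (BondConfig V) := {ω | (A.filter fun z => ω ∈ openConn y z).card ≤ j} with hRy
  set Q : Set (BondConfig V) := openConn o x with hQ
  have hmeas : ∀ S : Set (BondConfig V), MeasurableSet S := fun S => (Set.toFinite S).measurableSet
  -- the six cells
  have sx : μ.real (Rx ∩ Ry) + μ.real (Rx \ Ry) = μ.real Rx := measureReal_inter_add_sdiff (hmeas Ry)
  have sy : μ.real (Ry ∩ Rx) + μ.real (Ry \ Rx) = μ.real Ry := measureReal_inter_add_sdiff (hmeas Rx)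
  have sqx : μ.real (Q ∩ Rx ∩ Ry) + μ.real ((Q ∩ Rx) \ Ry) = μ.real (Q ∩ Rx) :=
    measureReal_inter_add_sdiff (hmeas Ry)
  have sqy : μ.real (Q ∩ Ry ∩ Rx) + μ.real ((Q ∩ Ry) \ Rx) = μ.real (Q ∩ Ry) :=
    measureReal_inter_add_sdiff (hmeas Rx)
  have eC : μ.real (Ry ∩ Rx) = μ.real (Rx ∩ Ry) := by rw [inter_comm]
  have eqC : μ.real (Q ∩ Ry ∩ Rx) = μ.real (Q ∩ Rx ∩ Ry) := by rw [inter_assoc, inter_comm Ry, ← inter_assoc]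
  have eF : Rx \ Ry = Rx ∩ Ryᶜ := Set.sdiff_eq Rx Ry
  have eG : Ry \ Rx = Rxᶜ ∩ Ry := by rw [Set.sdiff_eq, inter_comm]
  have eQF : (Q ∩ Rx) \ Ry = Q ∩ Rx ∩ Ryᶜ := Set.sdiff_eq (Q ∩ Rx) Ry
  have eQG : (Q ∩ Ry) \ Rx = Q ∩ Rxᶜ ∩ Ry := by rw [Set.sdiff_eq, inter_assoc, inter_comm Ry, ← inter_assoc]
  rw [eF] at sx; rw [eG, eC] at sy; rw [eQF] at sqx; rw [eQG, eqC] at sqy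
  -- names
  set C := μ.real (Rx ∩ Ry) with hC
  set F := μ.real (Rx ∩ Ryᶜ) with hF
  set G := μ.real (Rxᶜ ∩ Ry) with hG
  set qC := μ.real (Q ∩ Rx ∩ Ry) with hqC
  set qF := μ.real (Q ∩ Rx ∩ Ryᶜ) with hqF
  set qG := μ.real (Q ∩ Rxᶜ ∩ Ry) with hqG
  have hCn : 0 ≤ C := measureReal_nonneg
  have hFn : 0 ≤ F := measureReal_nonneg
  have hGn : 0 ≤ G := measureReal_nonneg
  have hqCn : 0 ≤ qC := measureReal_nonneg
  have hqFn : 0 ≤ qF := measureReal_nonneg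
  have hqGn : 0 ≤ qG := measureReal_nonneg
  -- the diamond and the hypotheses in cell form
  have dia : qF * G ≤ qG * F := lightnessDiamond w A o x y j hxy
  have hGF : G ≤ F := by linarith
  have neg : (C + F) * qF ≤ (qC + qF) * F := by rw [sx, sqx]; exact hNEG
  -- goal in cell form
  rw [← sx, ← sy, ← sqx, ← sqy]
  -- L = C qF − qC F ≤ 0 (NEG);  R = (C+F) qG − (qC+qF) G;  G·L ≤ F·R (diamond);  G ≤ F.
  have hL : C * qF - qC * F ≤ 0 := by nlinarith
  have hGL : G * (C * qF - qC * F) ≤ F * ((C + F) * qG - (qC + qF) * G) := by nlinarith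
  by_cases hR : 0 ≤ (C + F) * qG - (qC + qF) * G
  · nlinarith
  · have hR : (C + F) * qG - (qC + qF) * G < 0 := lt_of_not_ge hR
    by_cases hG0 : G = 0
    · -- then R = (C+F) qG ≥ 0, contradiction
      exfalso
      have : 0 ≤ (C + F) * qG - (qC + qF) * G := by rw [hG0]; nlinarith
      linarith
    · have hGpos : 0 < G := lt_of_le_of_ne hGn (Ne.symm hG0)
      have hFR : F * ((C + F) * qG - (qC + qF) * G) ≤ G * ((C + F) * qG - (qC + qF) * G) := by
        nlinarith
      have : C * qF - qC * F ≤ (C + F) * qG - (qC + qF) * G := by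
        have h' : G * (C * qF - qC * F) ≤ G * ((C + F) * qG - (qC + qF) * G) := le_trans hGL hFR
        exact le_of_mul_le_mul_left h' hGpos
      nlinarith

end Summit.CriticalPhenomena.PercolationContinuityZ3.Theorems

end
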